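import Mathlib.Analysis.Calculus.MeanValue
import Mathlib.Topology.Order.Compact
import HarnessLib

/-!
# A `C²` curve with `‖x''‖ ≤ C ‖x'‖²` and `x' ≠ 0` on a half-line does not converge

Analysis/ODE support file (pure normed-space calculus, everything proved; no definitions, no
named facts introduced). The main result `not_tendsto_nhds_of_norm_accel_le`: if `x u w : ℝ → F`
(`F` a real normed space) satisfy `x' = u`, `u' = w`, `‖w t‖ ≤ C ‖u t‖ ^ 2` and `u t ≠ 0` for all
`t ≥ t₀`, then `x t` has no limit as `t → ∞`. This is the calculus core of the endlessness of
affinely parametrised geodesic rays (the scaling/bootstrap estimate behind O'Neill,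
*Semi-Riemannian geometry* (1983), Ch. 5, Lemma 8, and Lee, *Introduction to Riemannian
Manifolds* (2018), Lemma 6.19, the escape lemma): in a chart at a would-be endpoint the
coordinate curve of a geodesic satisfies `x'' = -Γ(x)(x', x')` with `Γ` bounded.

Proof idea (scaling + bootstrap). WLOG `C ≥ 1`. Fix `t₁ ≥ t₀`, put `λ := ‖u t₁‖ > 0` and take the
window `[t₁, t₁ + h]` with `h := 1 / (8 C λ)`, so that `4 C λ h = 1/2 < 1`.
* `norm_sub_le_of_norm_accel_le` (bootstrap): on the window `‖u t - u t₁‖ ≤ C (2λ)² (t - t₁)`;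
  indeed at the first time `τ` with `‖u τ‖ ≥ 2λ` the mean value inequality (derivative bound
  `‖w‖ ≤ C (2λ)²` before `τ`) gives `‖u τ‖ ≤ λ + 4 C λ² h < 2λ`, absurd, so `‖u‖ < 2λ` throughout
  and the mean value inequality applies on the whole window.
* `norm_sub_sub_smul_le_of_norm_sub_le` (displacement): the mean value inequality for
  `t ↦ x t - t • u t₁` gives `‖x (t₁ + h) - x t₁ - h • u t₁‖ ≤ δ h` whenever `‖u - u t₁‖ ≤ δ`.
* `le_norm_sub_of_norm_accel_le` (key estimate): with `δ = 4 C λ² h` this yields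
  `‖x (t₁ + h) - x t₁‖ ≥ h λ - 4 C λ² h² = 1 / (16 C)`, a lower bound independent of `t₁`.
Since `t₁ ≥ t₀` is arbitrary and `h ≥ 0`, `x` is not Cauchy at `+∞`, hence does not converge.

Mathlib: `norm_image_sub_le_of_norm_deriv_le_segment'` (mean value inequality, derivative bound
only on `Ico`), `IsCompact.exists_isLeast` (first exit time), `Metric.tendsto_atTop`.
-/

namespace Literature.Analysis.ODE

open Set Filter Topology

/-- **Bootstrap.** If `u' = w` and `‖w‖ ≤ C ‖u‖²` on `[t₁, t₁ + h]`, `‖u t₁‖ > 0` and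
`4 C ‖u t₁‖ h < 1`, then `‖u t - u t₁‖ ≤ C (2 ‖u t₁‖)² (t - t₁)` on the window (first-exit-time
argument plus the mean value inequality). [folklore] -/
theorem norm_sub_le_of_norm_accel_le {F : Type*} [NormedAddCommGroup F] [NormedSpace ℝ F]
    {u w : ℝ → F} {C t₁ h : ℝ} (hC : 0 ≤ C)
    (hu : ∀ t ∈ Icc t₁ (t₁ + h), HasDerivAt u (w t) t)
    (hw : ∀ t ∈ Icc t₁ (t₁ + h), ‖w t‖ ≤ C * ‖u t‖ ^ 2)
    (hl : 0 < ‖u t₁‖) (hsmall : 4 * C * ‖u t₁‖ * h < 1) :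
    ∀ t ∈ Icc t₁ (t₁ + h), ‖u t - u t₁‖ ≤ C * (2 * ‖u t₁‖) ^ 2 * (t - t₁) := by
  -- the mean value inequality on an initial segment `[t₁, τ]` before which `‖u‖ < 2λ`
  have key : ∀ τ ∈ Icc t₁ (t₁ + h), (∀ s ∈ Ico t₁ τ, ‖u s‖ < 2 * ‖u t₁‖) →
      ∀ t ∈ Icc t₁ τ, ‖u t - u t₁‖ ≤ C * (2 * ‖u t₁‖) ^ 2 * (t - t₁) := by
    intro τ hτ hlt
    refine norm_image_sub_le_of_norm_deriv_le_segment'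
      (fun s hs => (hu s ⟨hs.1, hs.2.trans hτ.2⟩).hasDerivWithinAt) fun s hs => ?_
    calc ‖w s‖ ≤ C * ‖u s‖ ^ 2 := hw s ⟨hs.1, hs.2.le.trans hτ.2⟩
      _ ≤ C * (2 * ‖u t₁‖) ^ 2 := by
        gcongr
        exact (hlt s hs).le
  -- it suffices to bound `‖u‖ < 2λ` on `[t₁, t₁ + h)`
  suffices H : ∀ s ∈ Ico t₁ (t₁ + h), ‖u s‖ < 2 * ‖u t₁‖ by
    rcases le_or_gt t₁ (t₁ + h) with hh | hh
    · exact key (t₁ + h) (right_mem_Icc.2 hh) H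
    · intro t ht
      exact absurd (ht.1.trans ht.2) (not_le.2 hh)
  -- first-exit-time argument
  by_contra! hex
  obtain ⟨s₀, hs₀, hs₀'⟩ := hex
  set B : Set ℝ := Icc t₁ (t₁ + h) ∩ (fun t => ‖u t‖) ⁻¹' Ici (2 * ‖u t₁‖)
  have hcont : ContinuousOn (fun t => ‖u t‖) (Icc t₁ (t₁ + h)) :=
    fun t ht => (hu t ht).continuousAt.norm.continuousWithinAt
  have hBc : IsClosed B := hcont.preimage_isClosed_of_isClosed isClosed_Icc isClosed_Ici
  have hBk : IsCompact B := isCompact_Icc.of_isClosed_subset hBc inter_subset_left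
  obtain ⟨τ, hτB, hτle⟩ := hBk.exists_isLeast ⟨s₀, Ico_subset_Icc_self hs₀, hs₀'⟩
  have hτI : τ ∈ Icc t₁ (t₁ + h) := hτB.1
  have hτ2 : 2 * ‖u t₁‖ ≤ ‖u τ‖ := hτB.2
  have hbefore : ∀ s ∈ Ico t₁ τ, ‖u s‖ < 2 * ‖u t₁‖ := by
    intro s hs
    by_contra! hs'
    exact (not_le.2 hs.2) (hτle ⟨⟨hs.1, hs.2.le.trans hτI.2⟩, hs'⟩)
  have hτest := key τ hτI hbefore τ (right_mem_Icc.2 hτI.1)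
  have hlt : ‖u τ‖ < 2 * ‖u t₁‖ :=
    calc ‖u τ‖ ≤ ‖u t₁‖ + ‖u τ - u t₁‖ := norm_le_norm_add_norm_sub' _ _
      _ ≤ ‖u t₁‖ + C * (2 * ‖u t₁‖) ^ 2 * (τ - t₁) := by gcongr
      _ ≤ ‖u t₁‖ + C * (2 * ‖u t₁‖) ^ 2 * h := by gcongr; linarith [hτI.2]
      _ = ‖u t₁‖ + (4 * C * ‖u t₁‖ * h) * ‖u t₁‖ := by ring
      _ < ‖u t₁‖ + 1 * ‖u t₁‖ := by gcongr
      _ = 2 * ‖u t₁‖ := by ring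
  exact (not_le.2 hlt) hτ2

/-- **Displacement.** If `x' = u` on `[t₁, t₁ + h]` (`h ≥ 0`) and `‖u t - u t₁‖ ≤ δ` on
`[t₁, t₁ + h)`, then `‖x (t₁ + h) - x t₁ - h • u t₁‖ ≤ δ h` (mean value inequality for
`t ↦ x t - t • u t₁`). [folklore] -/
theorem norm_sub_sub_smul_le_of_norm_sub_le {F : Type*} [NormedAddCommGroup F]
    [NormedSpace ℝ F] {x u : ℝ → F} {t₁ h δ : ℝ}
    (hx : ∀ t ∈ Icc t₁ (t₁ + h), HasDerivAt x (u t) t)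
    (hδ : ∀ t ∈ Ico t₁ (t₁ + h), ‖u t - u t₁‖ ≤ δ) (hh : 0 ≤ h) :
    ‖x (t₁ + h) - x t₁ - h • u t₁‖ ≤ δ * h := by
  have hy : ∀ t ∈ Icc t₁ (t₁ + h),
      HasDerivWithinAt (fun s => x s - s • u t₁) (u t - u t₁) (Icc t₁ (t₁ + h)) t := by
    intro t ht
    have h1 : HasDerivAt (fun s : ℝ => s • u t₁) (u t₁) t := by
      simpa using (hasDerivAt_id t).smul_const (u t₁)
    exact ((hx t ht).sub h1).hasDerivWithinAt
  have := norm_image_sub_le_of_norm_deriv_le_segment' hy hδ (t₁ + h)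
    (right_mem_Icc.2 (le_add_of_nonneg_right hh))
  have heq : x (t₁ + h) - (t₁ + h) • u t₁ - (x t₁ - t₁ • u t₁) = x (t₁ + h) - x t₁ - h • u t₁ := by
    rw [add_smul]; abel
  rw [heq, add_sub_cancel_left] at this
  exact this

/-- **Key estimate.** If `x' = u`, `u' = w`, `‖w‖ ≤ C ‖u‖²` (`C > 0`) on the window
`[t₁, t₁ + h]` with `h := 1 / (8 C ‖u t₁‖)`, `‖u t₁‖ > 0`, then `‖x (t₁ + h) - x t₁‖ ≥ 1 / (16 C)`:
the curve travels a definite distance, independent of `t₁`. [folklore] -/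
theorem le_norm_sub_of_norm_accel_le {F : Type*} [NormedAddCommGroup F] [NormedSpace ℝ F]
    {x u w : ℝ → F} {C t₁ : ℝ} (hC : 0 < C)
    (hl : 0 < ‖u t₁‖)
    (hx : ∀ t ∈ Icc t₁ (t₁ + 1 / (8 * C * ‖u t₁‖)), HasDerivAt x (u t) t)
    (hu : ∀ t ∈ Icc t₁ (t₁ + 1 / (8 * C * ‖u t₁‖)), HasDerivAt u (w t) t)
    (hw : ∀ t ∈ Icc t₁ (t₁ + 1 / (8 * C * ‖u t₁‖)), ‖w t‖ ≤ C * ‖u t‖ ^ 2) :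
    1 / (16 * C) ≤ ‖x (t₁ + 1 / (8 * C * ‖u t₁‖)) - x t₁‖ := by
  set h : ℝ := 1 / (8 * C * ‖u t₁‖) with hh
  have hh0 : 0 ≤ h := by positivity
  have hprod : h * ‖u t₁‖ = 1 / (8 * C) := by
    rw [hh]; field_simp
  have hsmall : 4 * C * ‖u t₁‖ * h < 1 := by
    have : 4 * C * ‖u t₁‖ * h = 1 / 2 := by
      calc 4 * C * ‖u t₁‖ * h = 4 * C * (h * ‖u t₁‖) := by ring
        _ = 1 / 2 := by rw [hprod]; field_simp; norm_num
    rw [this]; norm_num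
  -- Step 1: bootstrap
  have h1 := norm_sub_le_of_norm_accel_le hC.le hu hw hl hsmall
  -- Step 2: displacement
  have h2 : ‖x (t₁ + h) - x t₁ - h • u t₁‖ ≤ C * (2 * ‖u t₁‖) ^ 2 * h * h :=
    norm_sub_sub_smul_le_of_norm_sub_le hx
      (fun t ht => (h1 t (Ico_subset_Icc_self ht)).trans (by gcongr; linarith [ht.2])) hh0
  have h2' : C * (2 * ‖u t₁‖) ^ 2 * h * h = 1 / (16 * C) := by
    calc C * (2 * ‖u t₁‖) ^ 2 * h * h = 4 * C * (h * ‖u t₁‖) ^ 2 := by ring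
      _ = 1 / (16 * C) := by rw [hprod]; field_simp; ring
  have h3 : ‖h • u t₁‖ = 2 * (1 / (16 * C)) := by
    rw [norm_smul, Real.norm_of_nonneg hh0, hprod]; field_simp; ring
  have h4 : ‖h • u t₁‖ ≤ ‖x (t₁ + h) - x t₁‖ + ‖x (t₁ + h) - x t₁ - h • u t₁‖ :=
    norm_le_norm_add_norm_sub _ _
  linarith

/-- **Escape under a quadratic acceleration bound.** Let `x u w : ℝ → F` satisfy `x' = u`,
`u' = w`, `‖w t‖ ≤ C ‖u t‖ ^ 2` and `u t ≠ 0` for all `t ≥ t₀`. Then `x t` does not converge as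
`t → ∞`. (Calculus core of: an affinely parametrised geodesic ray with non-vanishing velocity has
no endpoint — in a chart `x'' = -Γ(x)(x', x')` with `Γ` bounded near the would-be endpoint;
cf. O'Neill 1983, Ch. 5, Lemma 8; Lee 2018, Lemma 6.19.) Proof: WLOG `C ≥ 1`; by
`le_norm_sub_of_norm_accel_le` the curve travels at least `1 / (16 C)` on a window
`[t₁, t₁ + h]`, `h ≥ 0`, starting at any `t₁ ≥ t₀`, so it is not Cauchy. [folklore] -/
theorem not_tendsto_nhds_of_norm_accel_le {F : Type*} [NormedAddCommGroup F] [NormedSpace ℝ F]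
    {x u w : ℝ → F} {C t₀ : ℝ}
    (hx : ∀ t, t₀ ≤ t → HasDerivAt x (u t) t)
    (hu : ∀ t, t₀ ≤ t → HasDerivAt u (w t) t)
    (hw : ∀ t, t₀ ≤ t → ‖w t‖ ≤ C * ‖u t‖ ^ 2)
    (hu0 : ∀ t, t₀ ≤ t → u t ≠ 0) (x₀ : F) :
    ¬ Filter.Tendsto x Filter.atTop (nhds x₀) := by
  intro hlim
  -- WLOG the constant is `≥ 1`, in particular positive
  have hC : 0 < max C 1 := lt_of_lt_of_le one_pos (le_max_right _ _)
  have hw' : ∀ t, t₀ ≤ t → ‖w t‖ ≤ max C 1 * ‖u t‖ ^ 2 := fun t ht =>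
    (hw t ht).trans (mul_le_mul_of_nonneg_right (le_max_left _ _) (sq_nonneg _))
  have hε : (0 : ℝ) < 1 / (16 * max C 1) := by positivity
  obtain ⟨T, hT⟩ := Metric.tendsto_atTop.1 hlim (1 / (16 * max C 1) / 2) (half_pos hε)
  -- the window starts at `t₁ := max T t₀`
  have ht₁T : T ≤ max T t₀ := le_max_left _ _
  have ht₁0 : t₀ ≤ max T t₀ := le_max_right _ _
  have hl : 0 < ‖u (max T t₀)‖ := norm_pos_iff.2 (hu0 _ ht₁0)
  have hh0 : 0 ≤ 1 / (8 * max C 1 * ‖u (max T t₀)‖) := by positivity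
  have hkey := le_norm_sub_of_norm_accel_le hC hl (fun t ht => hx t (ht₁0.trans ht.1))
    (fun t ht => hu t (ht₁0.trans ht.1)) (fun t ht => hw' t (ht₁0.trans ht.1))
  have e1 := hT (max T t₀ + 1 / (8 * max C 1 * ‖u (max T t₀)‖))
    (ht₁T.trans (le_add_of_nonneg_right hh0))
  have e2 := hT (max T t₀) ht₁T
  have hlt : dist (x (max T t₀ + 1 / (8 * max C 1 * ‖u (max T t₀)‖))) (x (max T t₀))
      < 1 / (16 * max C 1) :=
    calc dist (x (max T t₀ + 1 / (8 * max C 1 * ‖u (max T t₀)‖))) (x (max T t₀))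
        ≤ dist (x (max T t₀ + 1 / (8 * max C 1 * ‖u (max T t₀)‖))) x₀ + dist (x (max T t₀)) x₀ :=
          dist_triangle_right _ _ _
      _ < 1 / (16 * max C 1) / 2 + 1 / (16 * max C 1) / 2 := add_lt_add e1 e2
      _ = 1 / (16 * max C 1) := add_halves _
  rw [dist_eq_norm] at hlt
  exact (not_le.2 hlt) hkey

end Literature.Analysis.ODE
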